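import Mathlib
import Literature.NumberTheory.LFunctions.FeketePolynomial
import Summits.ValiantsHypothesis.ValiantsHypothesis.Theses.FeketeSOS
import Summits.ValiantsHypothesis.ValiantsHypothesis.Theorems.FeketeSOSHard.Negative.LoadBearing

/-!
# `SublinearShadow` — negative lemmas: `p`-adic depth is unbounded at three squares and linear cost; padding makes
# every representation deep; the representation hypothesis is load-bearing

Crux `stmt-ValiantsHypothesis-14990` = `Summit.ValiantsHypothesis.ValiantsHypothesis.Theses.FeketeSOS.SublinearShadow`
(route FeketeSOS, rank 5): every complex weighted SOS representation `Σ_{i<s} c_i g_i² = F_p` of support-sum `S` with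
`S⁴ ≤ p³` has a characteristic-`p` cyclic shadow with `≤ (s+1)^A` squares and support `≤ (s+1)^A · S`.
Standing disprover (cdisprove gen 1, cycle 1); work file `Cruxes/SublinearShadow/Disproof.lean` §A–§B.
`𝔉⟮p⟯` is a local NOTATION for the crux's literal right-hand side `∑_{m<p} C (legendreSym p m) X^m` (no definitions here).

* §0 `inv_natCast_not_mem`, `pow_mul_neg_inv_pow_not_mem` — at a place `O ⊂ ℂ` above `p` (`p ∈ 𝔪_O`), `p⁻¹ ∉ O`, and
  `p^j · (−p^{−(k+1)}) ∉ O` for `j ≤ k`.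
* §A `sublinearShadow_false_without_rep` — the crux with the identity `Σ c_i g_i² = F_p` DELETED is false (witness `s = 0`:
  the conclusion would force `X^p − 1 ∣ F̄_p`, but `0 ≠ F̄_p` has degree `< p`).  Any proof must use the representation.
* §B `exists_deep_threeSquares` — for EVERY prime `p` and every `k` there is a representation of `F_p` by THREE weighted
  squares of degree `≤ p²` and support-sum `≤ 2p + 5` whose scalar term is `−p^{−(k+1)} · 1²`
  (`F_p = ¼(A+B)² − ¼(A−B)² − p^{−(k+1)}` with `A·B = F_p + p^{−(k+1)}`, `A = X − α` a linear factor over `ℂ`): at EVERY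
  valuation ring `O` of `ℂ` above `p` that term stays non-integral after multiplication by `p^k`.  So the good-reduction
  hypothesis of `DepthZeroShadow` fails for it at every place and every bounded denominator: p-adic DEPTH IS UNBOUNDED AT
  FIXED FAN-IN `s = 3` AND LINEAR COST.  Consequence for the line `Sketch` (`stub_orderBudgetFew`): a depth / order /
  ramification budget `≤ poly(s)` cannot follow from the target `F_p` and the shape of the equations — it must use the
  cost hypotheses (`S⁴ ≤ p³`, `(s+1)^B·S < 2p`) or Pareto-minimality (this sharpens `BarrierNotes-ideator2 §B1`, stated
  there for general right-hand sides, to `F_p` itself).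
* §B `exists_deep_padding` — padding ANY representation with `+p^{−(k+1)}·1² − p^{−(k+1)}·1²` gives one with two more
  squares, support-sum `+2`, and no place of good reduction (depth `> k` everywhere): IF a sublinear representation of cost
  `(s, S)` with `(S+2)⁴ ≤ p³` exists at all, then a sublinear one with no good place exists too — inside the crux's own
  hypothesis class the deep case is empty only if the whole class is (Pareto-minimality, not sublinearity, excludes it).
[folklore]
-/

namespace Summit.ValiantsHypothesis.ValiantsHypothesis.Theorems.SublinearShadow.Negative

open Polynomial Finset IsLocalRing
open scoped BigOperators
open Literature.NumberTheory.LFunctions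
open Summit.ValiantsHypothesis.ValiantsHypothesis.Theorems.FeketeSOSHard.Negative
  (card_support_add_le card_support_sub_le)

-- `Summit.ValiantsHypothesis.ValiantsHypothesis.…` is the tree's mandated single-conjunct layout (Sub = Summit).
set_option linter.dupNamespace false

noncomputable section

/-- `𝔉⟮p⟯ = F_p = ∑_{m<p} (m|p) X^m`, the crux's literal right-hand side. -/
local notation3 "𝔉⟮" p "⟯" =>
  (∑ m ∈ Finset.range p, Polynomial.C ((legendreSym p m : ℤ) : ℂ) * (Polynomial.X : Polynomial ℂ) ^ m)

/-! ## §0 Places of `ℂ` above `p` -/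

/-- At a valuation subring `O ⊂ ℂ` with `p ∈ 𝔪_O`, the inverse `p⁻¹` is not in `O`. [folklore] -/
theorem inv_natCast_not_mem (O : ValuationSubring ℂ) {p : ℕ} (hp : p ≠ 0)
    (hpO : ((p : ℕ) : O) ∈ maximalIdeal O) : (p : ℂ)⁻¹ ∉ O := by
  intro h
  have hpC : (p : ℂ) ≠ 0 := Nat.cast_ne_zero.mpr hp
  have hunit : IsUnit ((p : ℕ) : O) := by
    refine isUnit_iff_exists_inv.mpr ⟨⟨(p : ℂ)⁻¹, h⟩, ?_⟩
    apply Subtype.ext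
    change ((p : O) : ℂ) * (p : ℂ)⁻¹ = 1
    rw [show ((p : O) : ℂ) = (p : ℂ) from rfl, mul_inv_cancel₀ hpC]
  exact (mem_maximalIdeal _).mp hpO hunit

/-- Hence `p^j · (−p^{−(k+1)}) ∉ O` for `j ≤ k`: the scalar `−p^{−(k+1)}` stays non-integral at every place above `p`
after clearing `k` powers of `p` ("depth `> k`"). [folklore] -/
theorem pow_mul_neg_inv_pow_not_mem (O : ValuationSubring ℂ) {p : ℕ} (hp : p ≠ 0)
    (hpO : ((p : ℕ) : O) ∈ maximalIdeal O) {j k : ℕ} (hjk : j ≤ k) :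
    (p : ℂ) ^ j * (-((p : ℂ)⁻¹ ^ (k + 1))) ∉ O := by
  intro h
  have hpC : (p : ℂ) ≠ 0 := Nat.cast_ne_zero.mpr hp
  apply inv_natCast_not_mem O hp hpO
  have key : (p : ℂ)⁻¹ = -((p : ℂ) ^ (k - j) * ((p : ℂ) ^ j * (-((p : ℂ)⁻¹ ^ (k + 1))))) := by
    rw [mul_neg, mul_neg, neg_neg, ← mul_assoc, ← pow_add, Nat.sub_add_cancel hjk, pow_succ, ← mul_assoc,
      ← mul_pow, mul_inv_cancel₀ hpC, one_pow, one_mul]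
  rw [key]
  exact neg_mem (mul_mem (pow_mem (natCast_mem O p) _) h)

/-! ## §A The representation hypothesis is load-bearing -/

/-- The coefficient of `X¹` in `F̄_p = ∑_{m<p} (m|p) X^m` over any nontrivial ring is `(1|p) = 1`. [folklore] -/
theorem coeff_one_feketeSum (K : Type) [CommRing K] (p : ℕ) [Fact p.Prime] :
    (∑ m ∈ range p, C ((legendreSym p m : ℤ) : K) * X ^ m).coeff 1 = 1 := by
  have hp : 1 < p := (Fact.out : p.Prime).one_lt
  simp [hp]

/-- **`SublinearShadow` WITHOUT the representation hypothesis is false.**  Delete `Σ c_i g_i² = F_p` from the crux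
(everything else verbatim): then `s = 0` (no squares, support-sum `0`) forces a shadow with total support `≤ 0`, i.e.
`X^p − 1 ∣ F̄_p`, impossible since `F̄_p ≠ 0` has degree `< p`.  (The refuted Prop is spelled out inline.) [folklore] -/
theorem sublinearShadow_false_without_rep :
    ¬ (∃ A p₁ : ℕ, ∀ (p : ℕ) [Fact p.Prime], p₁ ≤ p → ∀ (s : ℕ) (c : Fin s → ℂ) (g : Fin s → Polynomial ℂ),
        (∀ i, (g i).natDegree ≤ p ^ 2) → (∑ i, (g i).support.card) ^ 4 ≤ p ^ 3 →
        ∃ (K : Type) (_ : Field K) (_ : CharP K p) (d : ℕ) (c' : Fin d → K) (g' : Fin d → Polynomial K),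
          d ≤ (s + 1) ^ A ∧ (∀ j, (g' j).natDegree < p) ∧
          (∑ j, (g' j).support.card) ≤ (s + 1) ^ A * ∑ i, (g i).support.card ∧
          ((Polynomial.X : Polynomial K) ^ p - 1 ∣ (∑ j, Polynomial.C (c' j) * g' j ^ 2)
            - ∑ m ∈ Finset.range p, Polynomial.C ((legendreSym p m : ℤ) : K) * Polynomial.X ^ m)) := by
  rintro ⟨A, p₁, h⟩
  obtain ⟨p, hp₁, hprime⟩ := Nat.exists_infinite_primes p₁
  haveI : Fact p.Prime := ⟨hprime⟩
  obtain ⟨K, _, _, d, c', g', -, hdeg, hsupp, hdvd⟩ :=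
    h p hp₁ 0 (fun i => Fin.elim0 i) (fun i => Fin.elim0 i) (fun i => Fin.elim0 i) (by simp)
  -- total support `≤ 0`: every `g'_j` vanishes
  have hsupp0 : ∑ j, (g' j).support.card = 0 := by
    have : (∑ j, (g' j).support.card) ≤ 0 := by simpa using hsupp
    omega
  have hg' : ∀ j, g' j = 0 := fun j => by
    have hj : (g' j).support.card = 0 := by
      have := Finset.sum_eq_zero_iff.mp hsupp0 j (Finset.mem_univ j)
      exact this
    simpa using hj
  have hzero : (∑ j, Polynomial.C (c' j) * g' j ^ 2) = 0 :=
    Finset.sum_eq_zero fun j _ => by rw [hg' j]; simp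
  rw [hzero, zero_sub, dvd_neg] at hdvd
  -- but `F̄_p ≠ 0` has degree `< p = deg (X^p − 1)`
  set F : Polynomial K := ∑ m ∈ Finset.range p, Polynomial.C ((legendreSym p m : ℤ) : K) * Polynomial.X ^ m with hF
  have hF0 : F ≠ 0 := fun h0 => by
    have h1 := coeff_one_feketeSum K p
    rw [← hF, h0, coeff_zero] at h1
    exact zero_ne_one h1
  have hFdeg : F.natDegree < p := by
    refine lt_of_le_of_lt (natDegree_sum_le_of_forall_le (n := p - 1) _ _ fun m hm => ?_) ?_
    · refine (natDegree_C_mul_X_pow_le _ _).trans ?_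
      have := Finset.mem_range.mp hm
      omega
    · exact Nat.sub_lt hprime.pos one_pos
  have hXp : ((Polynomial.X : Polynomial K) ^ p - 1).natDegree = p := by
    rw [← C_1, natDegree_X_pow_sub_C]
  have := natDegree_le_of_dvd hdvd hF0
  rw [hXp] at this
  omega

/-! ## §B Depth is unbounded at three squares and linear cost; padding -/

/-- `deg F_p = p − 1` for the crux's complex Fekete polynomial. [folklore] -/
theorem natDegree_feketeSum (p : ℕ) [Fact p.Prime] : (𝔉⟮p⟯).natDegree = p - 1 := by
  rw [← map_feketePolynomial_complex, natDegree_map_eq_of_injective (Int.castRingHom ℂ).injective_int,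
    natDegree_feketePolynomial]

/-- `F_p ≠ 0` over `ℂ` (coefficient `1` at `X¹`). [folklore] -/
theorem feketeSum_ne_zero (p : ℕ) [Fact p.Prime] : (𝔉⟮p⟯) ≠ 0 := fun h0 => by
  have h1 := coeff_one_feketeSum ℂ p
  rw [h0, coeff_zero] at h1
  exact zero_ne_one h1

/-- **Deep three-square representations of `F_p` (every prime `p`, every depth `k`).**
`F_p = ¼(A+B)² − ¼(A−B)² − p^{−(k+1)}·1²` where `A = X − α`, `B = (F_p + p^{−(k+1)})/(X − α)` for a complex root `α`
of `F_p + p^{−(k+1)}`: three weighted squares of degree `≤ p²`, support-sum `≤ 2p + 5`, and the scalar term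
`−p^{−(k+1)}` is non-integral at EVERY valuation ring `O ⊂ ℂ` above `p` even after multiplication by `p^j`, `j ≤ k`.
Hence the good-reduction hypothesis of `DepthZeroShadow` fails for it (at every place, with every denominator `p^k`):
positive depth is unbounded at fan-in `3` and linear cost, so no depth/order budget follows from the target alone. [folklore] -/
theorem exists_deep_threeSquares (p : ℕ) [Fact p.Prime] (k : ℕ) :
    ∃ (c : Fin 3 → ℂ) (g : Fin 3 → ℂ[X]),
      (∀ i, (g i).natDegree ≤ p ^ 2) ∧
      (∑ i, C (c i) * g i ^ 2) = 𝔉⟮p⟯ ∧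
      (∑ i, (g i).support.card) ≤ 2 * p + 5 ∧
      c 2 = -((p : ℂ)⁻¹ ^ (k + 1)) ∧ g 2 = 1 ∧
      (∀ O : ValuationSubring ℂ, ((p : ℕ) : O) ∈ maximalIdeal O →
        ∀ j ≤ k, (p : ℂ) ^ j * (C (c 2) * g 2 ^ 2).coeff 0 ∉ O) := by
  have hprime : p.Prime := Fact.out
  have hp2 : 2 ≤ p := hprime.two_le
  set ε : ℂ := (p : ℂ)⁻¹ ^ (k + 1) with hε
  set F : ℂ[X] := 𝔉⟮p⟯ with hF
  have hFdeg : F.natDegree = p - 1 := natDegree_feketeSum p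
  have hF0 : F ≠ 0 := feketeSum_ne_zero p
  have hdegF : 0 < F.degree := by
    rw [degree_eq_natDegree hF0, hFdeg]
    exact_mod_cast (by omega : 0 < p - 1)
  have hdegFε : (F + C ε).degree = F.degree := degree_add_C hdegF
  have hnatFε : (F + C ε).natDegree = p - 1 := by rw [natDegree_add_C, hFdeg]
  -- a linear factor over `ℂ`
  obtain ⟨α, hα⟩ := Complex.exists_root (by rw [hdegFε]; exact hdegF)
  set A : ℂ[X] := X - C α with hA
  set B : ℂ[X] := (F + C ε) /ₘ (X - C α) with hB
  have hAB : (X - C α) * B = F + C ε := mul_divByMonic_eq_iff_isRoot.mpr hα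
  have hAdeg : A.natDegree = 1 := natDegree_X_sub_C α
  have hBdeg : B.natDegree = p - 2 := by
    rw [hB, natDegree_divByMonic _ (monic_X_sub_C α), hnatFε, natDegree_X_sub_C]
    omega
  have hAcard : A.support.card ≤ 2 := (card_supp_le_succ_natDegree A).trans (by rw [hAdeg])
  have hBcard : B.support.card ≤ p - 1 := (card_supp_le_succ_natDegree B).trans (by rw [hBdeg]; omega)
  have hp22 : p - 1 ≤ p ^ 2 := (Nat.sub_le p 1).trans (Nat.le_self_pow two_ne_zero p)
  have h1p2 : 1 ≤ p ^ 2 := le_trans (by omega) hp22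
  have hABdeg : (A + B).natDegree ≤ p ^ 2 :=
    (natDegree_add_le _ _).trans (max_le (by rw [hAdeg]; exact h1p2) (by rw [hBdeg]; omega))
  have hABdeg' : (A - B).natDegree ≤ p ^ 2 :=
    (natDegree_sub_le _ _).trans (max_le (by rw [hAdeg]; exact h1p2) (by rw [hBdeg]; omega))
  have h4 : C (4⁻¹ : ℂ) * 4 = (1 : ℂ[X]) := by
    rw [← Polynomial.C_ofNat, ← map_mul, inv_mul_cancel₀ (by norm_num : (4 : ℂ) ≠ 0), map_one]
  refine ⟨![4⁻¹, -4⁻¹, -ε], ![A + B, A - B, 1], ?_, ?_, ?_, ?_, ?_, ?_⟩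
  · intro i
    fin_cases i
    · exact hABdeg
    · exact hABdeg'
    · simp
  · rw [Fin.sum_univ_three]
    simp only [Matrix.cons_val_zero, Matrix.cons_val_one, Matrix.cons_val_two, Matrix.tail_cons,
      Matrix.head_cons, map_neg, one_pow, mul_one]
    rw [hA]
    linear_combination ((X - C α) * B) * h4 + hAB
  · rw [Fin.sum_univ_three]
    simp only [Matrix.cons_val_zero, Matrix.cons_val_one, Matrix.cons_val_two, Matrix.tail_cons,
      Matrix.head_cons]
    have h1 : (1 : ℂ[X]).support.card ≤ 1 := (card_supp_le_succ_natDegree _).trans (by simp)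
    have hs1 := (card_support_add_le A B).trans (Nat.add_le_add hAcard hBcard)
    have hs2 := (card_support_sub_le A B).trans (Nat.add_le_add hAcard hBcard)
    omega
  · simp
  · simp
  · intro O hpO j hj
    simp only [Matrix.cons_val_two, Matrix.tail_cons, Matrix.head_cons, one_pow, mul_one, coeff_C_zero]
    exact pow_mul_neg_inv_pow_not_mem O hprime.ne_zero hpO hj

/-- **Padding makes any representation deep.**  From `Σ_{i<s} c_i g_i² = F_p` build
`Σ_{i<s} c_i g_i² + p^{−(k+1)}·1² − p^{−(k+1)}·1² = F_p`: two more squares, support-sum `+2` at most, the old squares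
untouched, and the last term non-integral at every place of `ℂ` above `p` after multiplication by `p^j`, `j ≤ k`.  In
particular, if a representation with `(S+2)⁴ ≤ p³` exists, so does a SUBLINEAR one without any place of good reduction:
inside the crux's hypothesis class the deep case is excluded by Pareto-minimality only, never by sublinearity. [folklore] -/
theorem exists_deep_padding (p : ℕ) [Fact p.Prime] (k : ℕ) {s : ℕ} (c : Fin s → ℂ) (g : Fin s → ℂ[X])
    (hrep : (∑ i, C (c i) * g i ^ 2) = 𝔉⟮p⟯) :
    ∃ (c' : Fin (s + 2) → ℂ) (g' : Fin (s + 2) → ℂ[X]),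
      (∑ i, C (c' i) * g' i ^ 2) = 𝔉⟮p⟯ ∧
      (∀ i : Fin s, c' (Fin.castAdd 2 i) = c i ∧ g' (Fin.castAdd 2 i) = g i) ∧
      (∀ i : Fin 2, g' (Fin.natAdd s i) = 1) ∧
      (∑ i, (g' i).support.card) ≤ (∑ i, (g i).support.card) + 2 ∧
      c' (Fin.natAdd s 1) = -((p : ℂ)⁻¹ ^ (k + 1)) ∧
      (∀ O : ValuationSubring ℂ, ((p : ℕ) : O) ∈ maximalIdeal O →
        ∀ j ≤ k, (p : ℂ) ^ j * (C (c' (Fin.natAdd s 1)) * g' (Fin.natAdd s 1) ^ 2).coeff 0 ∉ O) := by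
  have hprime : p.Prime := Fact.out
  set ε : ℂ := (p : ℂ)⁻¹ ^ (k + 1) with hε
  refine ⟨Fin.append c ![ε, -ε], Fin.append g ![1, 1], ?_, ?_, ?_, ?_, ?_, ?_⟩
  · rw [Fin.sum_univ_add, ← hrep]
    simp [Fin.sum_univ_two]
  · intro i
    simp
  · intro i
    fin_cases i <;> simp
  · rw [Fin.sum_univ_add]
    have h1 : (1 : ℂ[X]).support.card ≤ 1 := (card_supp_le_succ_natDegree _).trans (by simp)
    have h2 : ∑ i : Fin 2, (Fin.append g ![1, 1] (Fin.natAdd s i)).support.card ≤ 2 := by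
      rw [Fin.sum_univ_two]
      simp only [Fin.append_right, Matrix.cons_val_zero, Matrix.cons_val_one]
      omega
    simp only [Fin.append_left]
    omega
  · simp
  · intro O hpO j hj
    have e1 : Fin.append c ![ε, -ε] (Fin.natAdd s 1) = -ε := by simp
    have e2 : Fin.append g ![1, 1] (Fin.natAdd s 1) = 1 := by simp
    rw [e1, e2, one_pow, mul_one, coeff_C_zero]
    exact pow_mul_neg_inv_pow_not_mem O hprime.ne_zero hpO hj

end

end Summit.ValiantsHypothesis.ValiantsHypothesis.Theorems.SublinearShadow.Negative
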